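import Summits.QuantumFields.BalabanUV.T4Continuum.Support.ShellMeasureAverageLipschitz

/-!
# `T4Continuum.ShellMeasureAverageLipschitzChart` — WALL §3 W-d, ANALYTIC HALF WITHOUT SCHWARZ (generic core, part 2):
# the exp-mean-log EXPONENT over telescoped loops, the QUOTIENT `Z(B) = e^{S(B)}T(B)(e^{S(0)}T(0))⁻¹` within an EXPLICIT
# distance of `1` (no radius division), and the chart average `F = (−i)·log Z` — ANALYTIC on `ball 0 R`, `‖F‖ ≤ −ln(1 − f)`
(cell `pub-balaban`, sub-cell `t4`, spine estimate NE7c (node U5b); NE7c ROUND-2 crew `t4-ne7c-formalise-*`, seat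
`b2b-balaban-t4-ne7c-formalise-leaf-06` gen 8, own-initiative OFFER «γ9″ THE W-d WINDOW WITHOUT SCHWARZ» (journal
`HOME/CLAIMS.log` l.20097, owner ruling R-ne7cp1-g34-4 (b)), file 1b; imports part 1 `ShellMeasureAverageLipschitz` ONLY;
[folklore] elementary analysis in a complete normed algebra; 0 `def`, 0 `def … : Prop`, 0 sorry, 0 citations)

HONEST FRAMING.  Finite four-torus programme, rung (B)+1 only — NOT infinite volume, NOT a mass gap, NOT the Clay
problem, NOT summit progress; (B), `BetaPertHyp`, (B^μ) are not consumed.  NE7c (`T4IndicatorShell.ShellWeightBound`)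
is NOT PRINTED and NOT PROVED; «NE7c ⇐ the named binders».  A sharpening of OUR OWN constants (S49's radius); nothing
printed is asserted, quantified or disputed; NOTHING in the countdown moves; spine PROVED 0∕9.  HONEST DEPENDENCY (cell,
verbatim): continuum YM on T⁴ ⇐ BetaPertH ∧ nine spine estimates (0/9 proved); BetaPertH ⇐ (D1) ∧ (D4) ∧ CAP+tail;
G-an2-4 gates asym, D1 and NE2/3/4.

THE POINT (continuing part 1, whose `LipWord`, `norm_mlog_sub_mlog_le` are used BY NAME, with the tree's
`Literature.Analysis.Complex.norm_exp_sub_exp_le`).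
* §2 the EXPONENT `S(B) = Σ_{x∈s} a_x • log W_x(B)` over `LipWord` loops of weight `w ≥ 0` with `‖W_x(0) − 1‖ ≤ ε`,
  `Σ‖a_x‖ ≤ 1`: on `‖B‖ < R`, under the loop regime `r₁ := ε + (e^{wR} − 1) < 1`, every loop stays in `{‖X − 1‖ ≤ r₁}`
  (`norm_loop_sub_one_le`), `S` is analytic (`analyticAt_exponent_sharp`), **`norm_exponent_sub_le`**
  `‖S(B) − S(0)‖ ≤ (e^{w‖B‖} − 1)∕(1 − r₁)`, **`norm_exponent_zero_le`** `‖S(0)‖ ≤ ε∕(1 − ε)` ((26) p. 22).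
* §3 the QUOTIENT: for a `LipWord` transporter `T` of weight `w_T` and ANY exponent `S` with `‖S 0‖ ≤ σ₀`,
  `‖S B − S 0‖ ≤ α`: **`norm_quot_sub_one_le_sharp`** `‖Z(B) − 1‖ ≤ e^{2σ₀}·(α·e^{α}·e^{w_T‖B‖} + (e^{w_T‖B‖} − 1))`, from
  `Z − 1 = (e^{S(B)} − e^{S(0)})·T(B)T(0)⁻¹·e^{−S(0)} + e^{S(0)}·(T(B) − T(0))T(0)⁻¹·e^{−S(0)}` and the tree's
  `norm_exp_sub_exp_le` (`Literature.Analysis.Complex.RungeUnits`); hence, for any `f < 1`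
  dominating the right side at `‖B‖ = R`: **`chartAverage_analyticOnNhd_sharp`** (`F = (−i)·log Z` is `AnalyticOnNhd ℂ`
  on `ball 0 R`) and **`norm_chartAverage_le_sharp`** (`‖F(B)‖ ≤ −ln(1 − f)` on the ball; (26) p. 22, first member).
The instance for the printed average [B7] (15) — loops of weight `w = 2(d+1)L`, `T = U(c)` of weight `L`, `R♯ = 1∕(8w)`,
`f < 0.377`, `‖Q̃‖ ≤ 1∕2` — is `ShellMeasureAverageAnalyticB7Sharp`.  NOT HERE: anything about Bałaban's minimisers or
densities; the deeper lever (a direct second-variation bound replacing Cauchy's `Mq = 2M∕R²` inside S46) is NOT attempted.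
-/

noncomputable section

open NormedSpace Metric Set

namespace Summit.QuantumFields.BalabanUV.T4Continuum.ShellMeasureAverageLipschitzChart

open Literature.MathematicalPhysics.QuantumFieldTheory.Balaban1983to89
open B12AverageCorridor267 (expU val_expU val_inv_expU)
open MatrixLog (mlog analyticAt_mlog hasSum_mlog norm_mlog_le_div norm_mlog_le_neg_log)
open ShellMeasureAverageAnalytic
open ShellMeasureAverageLipschitz

variable {E : Type*} [NormedAddCommGroup E] [NormedSpace ℂ E]
variable {𝔸 : Type*} [NormedRing 𝔸] [NormedAlgebra ℂ 𝔸]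

/-! ## §2 The exponent over telescoped loops: regime, analyticity, motion, size at `0` -/

section Exponent

variable [CompleteSpace 𝔸] [NormOneClass 𝔸] {σ : Type*} {s : Finset σ} {a : σ → ℂ} {W : σ → E → 𝔸ˣ} {w ε R : ℝ}

omit [CompleteSpace 𝔸] [NormOneClass 𝔸] in
/-- **THE LOOP REGIME**: a `LipWord` loop with `‖W(0) − 1‖ ≤ ε` stays in `{‖X − 1‖ ≤ ε + (e^{wR} − 1)}` on `‖B‖ < R`.
[folklore] -/
theorem norm_loop_sub_one_le {f : E → 𝔸ˣ} (hf : LipWord f w) (hε : ‖((f 0 : 𝔸ˣ) : 𝔸) - 1‖ ≤ ε) {B : E}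
    (hB : ‖B‖ < R) : ‖((f B : 𝔸ˣ) : 𝔸) - 1‖ ≤ ε + (Real.exp (w * R) - 1) := by
  have h1 := hf.sub_le B
  have h2 : Real.exp (w * ‖B‖) ≤ Real.exp (w * R) :=
    Real.exp_le_exp.2 (mul_le_mul_of_nonneg_left hB.le hf.expWord.nonneg)
  calc ‖((f B : 𝔸ˣ) : 𝔸) - 1‖ = ‖(((f B : 𝔸ˣ) : 𝔸) - ((f 0 : 𝔸ˣ) : 𝔸)) + (((f 0 : 𝔸ˣ) : 𝔸) - 1)‖ := by
        rw [sub_add_sub_cancel]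
    _ ≤ ‖((f B : 𝔸ˣ) : 𝔸) - ((f 0 : 𝔸ˣ) : 𝔸)‖ + ‖((f 0 : 𝔸ˣ) : 𝔸) - 1‖ := norm_add_le _ _
    _ ≤ (Real.exp (w * R) - 1) + ε := add_le_add (h1.trans (by linarith)) hε
    _ = ε + (Real.exp (w * R) - 1) := add_comm _ _

/-- … hence its logarithm moves by at most `(e^{w‖B‖} − 1)∕(1 − r₁)`, `r₁ = ε + (e^{wR} − 1) < 1`. [folklore] -/
theorem norm_mlog_loop_sub_le {f : E → 𝔸ˣ} (hf : LipWord f w) (hε : ‖((f 0 : 𝔸ˣ) : 𝔸) - 1‖ ≤ ε)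
    (hr : ε + (Real.exp (w * R) - 1) < 1) {B : E} (hB : ‖B‖ < R) :
    ‖mlog ((f B : 𝔸ˣ) : 𝔸) - mlog ((f 0 : 𝔸ˣ) : 𝔸)‖ ≤ (Real.exp (w * ‖B‖) - 1) / (1 - (ε + (Real.exp (w * R) - 1))) := by
  have hR : 0 ≤ Real.exp (w * R) - 1 := by
    have : 0 ≤ w * R := mul_nonneg hf.expWord.nonneg ((norm_nonneg B).trans hB.le)
    linarith [Real.one_le_exp this]
  have h0 : ‖((f 0 : 𝔸ˣ) : 𝔸) - 1‖ ≤ ε + (Real.exp (w * R) - 1) := hε.trans (by linarith)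
  refine (norm_mlog_sub_mlog_le hr (norm_loop_sub_one_le hf hε hB) h0).trans ?_
  exact div_le_div_of_nonneg_right (hf.sub_le B) (by linarith)

variable (hW : ∀ x ∈ s, LipWord (W x) w) (hε : ∀ x ∈ s, ‖((W x 0 : 𝔸ˣ) : 𝔸) - 1‖ ≤ ε)
  (hr : ε + (Real.exp (w * R) - 1) < 1)
include hW hε hr

omit [NormOneClass 𝔸] in
/-- The EXPONENT `B ↦ Σ_{x∈s} a_x • log (W_x B)` is analytic at every `‖B‖ < R` (each loop is in the `log`-disc).
[folklore] -/
theorem analyticAt_exponent_sharp {B : E} (hB : ‖B‖ < R) :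
    AnalyticAt ℂ (fun B => ∑ x ∈ s, a x • mlog ((W x B : 𝔸ˣ) : 𝔸)) B :=
  Finset.analyticAt_fun_sum s fun x hx =>
    ((MatrixLog.analyticAt_mlog ((norm_loop_sub_one_le (hW x hx) (hε x hx) hB).trans_lt hr)).comp_of_eq
      ((hW x hx).expWord.an B) rfl).fun_const_smul

/-- **THE EXPONENT MOVES BY AT MOST `(e^{w‖B‖} − 1)∕(1 − r₁)`** on `‖B‖ < R` when `Σ‖a_x‖ ≤ 1`. [folklore] -/
theorem norm_exponent_sub_le (hw : 0 ≤ w) (ha : ∑ x ∈ s, ‖a x‖ ≤ 1) {B : E} (hB : ‖B‖ < R) :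
    ‖∑ x ∈ s, a x • mlog ((W x B : 𝔸ˣ) : 𝔸) - ∑ x ∈ s, a x • mlog ((W x 0 : 𝔸ˣ) : 𝔸)‖
      ≤ (Real.exp (w * ‖B‖) - 1) / (1 - (ε + (Real.exp (w * R) - 1))) := by
  set K := (Real.exp (w * ‖B‖) - 1) / (1 - (ε + (Real.exp (w * R) - 1))) with hK
  have hK0 : 0 ≤ K := by
    rw [hK]
    refine div_nonneg ?_ (by linarith)
    linarith [Real.one_le_exp (mul_nonneg hw (norm_nonneg B))]
  rw [← Finset.sum_sub_distrib]
  calc ‖∑ x ∈ s, (a x • mlog ((W x B : 𝔸ˣ) : 𝔸) - a x • mlog ((W x 0 : 𝔸ˣ) : 𝔸))‖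
      ≤ ∑ x ∈ s, ‖a x • mlog ((W x B : 𝔸ˣ) : 𝔸) - a x • mlog ((W x 0 : 𝔸ˣ) : 𝔸)‖ := norm_sum_le _ _
    _ ≤ ∑ x ∈ s, ‖a x‖ * K := Finset.sum_le_sum fun x hx => by
        rw [← smul_sub, norm_smul]
        exact mul_le_mul_of_nonneg_left (norm_mlog_loop_sub_le (hW x hx) (hε x hx) hr hB) (norm_nonneg _)
    _ = (∑ x ∈ s, ‖a x‖) * K := (Finset.sum_mul _ _ _).symm
    _ ≤ 1 * K := mul_le_mul_of_nonneg_right ha hK0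
    _ = K := one_mul K

/-- … uniformly on the ball: `‖S(B) − S(0)‖ ≤ (e^{wR} − 1)∕(1 − r₁)` for `‖B‖ < R`. [folklore] -/
theorem norm_exponent_sub_le_of_ball (hw : 0 ≤ w) (ha : ∑ x ∈ s, ‖a x‖ ≤ 1) {B : E} (hB : ‖B‖ < R) :
    ‖∑ x ∈ s, a x • mlog ((W x B : 𝔸ˣ) : 𝔸) - ∑ x ∈ s, a x • mlog ((W x 0 : 𝔸ˣ) : 𝔸)‖
      ≤ (Real.exp (w * R) - 1) / (1 - (ε + (Real.exp (w * R) - 1))) := by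
  refine (norm_exponent_sub_le hW hε hr hw ha hB).trans (div_le_div_of_nonneg_right ?_ (by linarith))
  exact sub_le_sub_right (Real.exp_le_exp.2 (mul_le_mul_of_nonneg_left hB.le hw)) 1

omit [NormedSpace ℂ E] [NormOneClass 𝔸] hW hr in
/-- **THE EXPONENT AT `0` IS AT MOST `ε∕(1 − ε)`** (`ε < 1`, `Σ‖a_x‖ ≤ 1`; (26) p. 22 `‖log X‖ ≤ ‖X − 1‖∕(1 − ‖X − 1‖)`).
[folklore] -/
theorem norm_exponent_zero_le (hε0 : 0 ≤ ε) (hε1 : ε < 1) (ha : ∑ x ∈ s, ‖a x‖ ≤ 1) :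
    ‖∑ x ∈ s, a x • mlog ((W x 0 : 𝔸ˣ) : 𝔸)‖ ≤ ε / (1 - ε) := by
  have hK0 : 0 ≤ ε / (1 - ε) := div_nonneg hε0 (by linarith)
  calc ‖∑ x ∈ s, a x • mlog ((W x 0 : 𝔸ˣ) : 𝔸)‖ ≤ ∑ x ∈ s, ‖a x • mlog ((W x 0 : 𝔸ˣ) : 𝔸)‖ := norm_sum_le _ _
    _ ≤ ∑ x ∈ s, ‖a x‖ * (ε / (1 - ε)) := Finset.sum_le_sum fun x hx => by
        rw [norm_smul]
        refine mul_le_mul_of_nonneg_left ?_ (norm_nonneg _)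
        have h1 : ‖((W x 0 : 𝔸ˣ) : 𝔸) - 1‖ < 1 := (hε x hx).trans_lt hε1
        refine (norm_mlog_le_div h1).trans ?_
        have ht : 0 < 1 - ‖((W x 0 : 𝔸ˣ) : 𝔸) - 1‖ := by linarith
        rw [div_le_div_iff₀ ht (by linarith)]
        nlinarith [hε x hx, norm_nonneg (((W x 0 : 𝔸ˣ) : 𝔸) - 1)]
    _ = (∑ x ∈ s, ‖a x‖) * (ε / (1 - ε)) := (Finset.sum_mul _ _ _).symm
    _ ≤ 1 * (ε / (1 - ε)) := mul_le_mul_of_nonneg_right ha hK0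
    _ = ε / (1 - ε) := one_mul _

end Exponent

/-! ## §3 The quotient `Z(B) = e^{S(B)}T(B)(e^{S(0)}T(0))⁻¹` and the chart average `F = (−i)·log Z`, sharp -/

section Quotient

variable [CompleteSpace 𝔸] [NormOneClass 𝔸] {S : E → 𝔸} {T : E → 𝔸ˣ} {wT σ₀ α : ℝ}

/-- **THE QUOTIENT MOVES FROM `1` BY AN EXPLICIT AMOUNT, NO RADIUS DIVISION**: for a `LipWord` transporter `T` of
weight `w_T` and any exponent `S` with `‖S 0‖ ≤ σ₀`, `‖S B − S 0‖ ≤ α`: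
`‖Z(B) − 1‖ ≤ e^{2σ₀}·(α·e^{α}·e^{w_T‖B‖} + (e^{w_T‖B‖} − 1))`, from
`Z − 1 = (e^{S B} − e^{S 0})·T(B)T(0)⁻¹·e^{−S 0} + e^{S 0}·(T(B) − T(0))T(0)⁻¹·e^{−S 0}`, `norm_exp_sub_exp_le` and the
telescoping bound of `T`. [folklore] -/
theorem norm_quot_sub_one_le_sharp (hT : LipWord T wT) (hS0 : ‖S 0‖ ≤ σ₀) {B : E} (hSB : ‖S B - S 0‖ ≤ α) :
    ‖(((expU (S B) * T B) * (expU (S 0) * T 0)⁻¹ : 𝔸ˣ) : 𝔸) - 1‖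
      ≤ Real.exp (2 * σ₀) * (α * Real.exp α * Real.exp (wT * ‖B‖) + (Real.exp (wT * ‖B‖) - 1)) := by
  have hα : 0 ≤ α := (norm_nonneg _).trans hSB
  have hσ : 0 ≤ σ₀ := (norm_nonneg _).trans hS0
  -- the pieces and their norms
  have hTB : ‖((T B : 𝔸ˣ) : 𝔸)‖ ≤ Real.exp (wT * ‖B‖) := hT.expWord.le B
  have hT0i : ‖(((T 0)⁻¹ : 𝔸ˣ) : 𝔸)‖ ≤ 1 := LipWord.norm_inv_apply_zero_le hT.expWord
  have hdT : ‖((T B : 𝔸ˣ) : 𝔸) - ((T 0 : 𝔸ˣ) : 𝔸)‖ ≤ Real.exp (wT * ‖B‖) - 1 := hT.sub_le B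
  have hSBn : ‖S B‖ ≤ σ₀ + α := by
    calc ‖S B‖ = ‖(S B - S 0) + S 0‖ := by rw [sub_add_cancel]
      _ ≤ ‖S B - S 0‖ + ‖S 0‖ := norm_add_le _ _
      _ ≤ α + σ₀ := add_le_add hSB hS0
      _ = σ₀ + α := add_comm _ _
  have hmax : max ‖S B‖ ‖S 0‖ ≤ σ₀ + α := max_le hSBn (hS0.trans (by linarith))
  have hE : ‖exp (S B) - exp (S 0)‖ ≤ Real.exp (σ₀ + α) * α := by
    rw [mul_comm]
    exact (Literature.Analysis.Complex.norm_exp_sub_exp_le (S B) (S 0)).trans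
      (mul_le_mul hSB (Real.exp_le_exp.2 hmax) (Real.exp_pos _).le hα)
  have hY : ‖exp (S 0)‖ ≤ Real.exp σ₀ := (norm_exp_le' _).trans (Real.exp_le_exp.2 hS0)
  have hYn : ‖exp (-S 0)‖ ≤ Real.exp σ₀ := (norm_exp_le' _).trans (Real.exp_le_exp.2 ((norm_neg _).le.trans hS0))
  -- `T(0)T(0)⁻¹ = 1`, `e^{S 0}e^{−S 0} = 1`
  have hTT : ((T 0 : 𝔸ˣ) : 𝔸) * (((T 0)⁻¹ : 𝔸ˣ) : 𝔸) = 1 := Units.mul_inv _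
  have hee : exp (S 0) * exp (-S 0) = (1 : 𝔸) := by
    have h := Units.mul_inv (expU (S 0)); rwa [val_expU, val_inv_expU] at h
  -- the decomposition
  have key : (((expU (S B) * T B) * (expU (S 0) * T 0)⁻¹ : 𝔸ˣ) : 𝔸) - 1
      = (exp (S B) - exp (S 0)) * (((T B : 𝔸ˣ) : 𝔸) * (((T 0)⁻¹ : 𝔸ˣ) : 𝔸)) * exp (-S 0)
        + exp (S 0) * ((((T B : 𝔸ˣ) : 𝔸) - ((T 0 : 𝔸ˣ) : 𝔸)) * (((T 0)⁻¹ : 𝔸ˣ) : 𝔸)) * exp (-S 0) := by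
    rw [val_quot, ← hee]
    have h2 : (((T B : 𝔸ˣ) : 𝔸) - ((T 0 : 𝔸ˣ) : 𝔸)) * (((T 0)⁻¹ : 𝔸ˣ) : 𝔸)
        = ((T B : 𝔸ˣ) : 𝔸) * (((T 0)⁻¹ : 𝔸ˣ) : 𝔸) - 1 := by rw [sub_mul, hTT]
    rw [h2]
    noncomm_ring
  rw [key]
  have hP : ‖((T B : 𝔸ˣ) : 𝔸) * (((T 0)⁻¹ : 𝔸ˣ) : 𝔸)‖ ≤ Real.exp (wT * ‖B‖) :=
    (norm_mul_le _ _).trans ((mul_le_mul hTB hT0i (norm_nonneg _) (Real.exp_pos _).le).trans (by rw [mul_one]))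
  have hPd0 : 0 ≤ Real.exp (wT * ‖B‖) - 1 := by
    linarith [Real.one_le_exp (mul_nonneg hT.expWord.nonneg (norm_nonneg B))]
  have hPd : ‖(((T B : 𝔸ˣ) : 𝔸) - ((T 0 : 𝔸ˣ) : 𝔸)) * (((T 0)⁻¹ : 𝔸ˣ) : 𝔸)‖ ≤ Real.exp (wT * ‖B‖) - 1 :=
    (norm_mul_le _ _).trans ((mul_le_mul hdT hT0i (norm_nonneg _) hPd0).trans (by rw [mul_one]))
  calc ‖(exp (S B) - exp (S 0)) * (((T B : 𝔸ˣ) : 𝔸) * (((T 0)⁻¹ : 𝔸ˣ) : 𝔸)) * exp (-S 0)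
        + exp (S 0) * ((((T B : 𝔸ˣ) : 𝔸) - ((T 0 : 𝔸ˣ) : 𝔸)) * (((T 0)⁻¹ : 𝔸ˣ) : 𝔸)) * exp (-S 0)‖
      ≤ ‖exp (S B) - exp (S 0)‖ * ‖((T B : 𝔸ˣ) : 𝔸) * (((T 0)⁻¹ : 𝔸ˣ) : 𝔸)‖ * ‖exp (-S 0)‖
        + ‖exp (S 0)‖ * ‖(((T B : 𝔸ˣ) : 𝔸) - ((T 0 : 𝔸ˣ) : 𝔸)) * (((T 0)⁻¹ : 𝔸ˣ) : 𝔸)‖ * ‖exp (-S 0)‖ := by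
        refine (norm_add_le _ _).trans (add_le_add ?_ ?_)
        · exact (norm_mul_le _ _).trans (mul_le_mul_of_nonneg_right (norm_mul_le _ _) (norm_nonneg _))
        · exact (norm_mul_le _ _).trans (mul_le_mul_of_nonneg_right (norm_mul_le _ _) (norm_nonneg _))
    _ ≤ (Real.exp (σ₀ + α) * α) * Real.exp (wT * ‖B‖) * Real.exp σ₀
        + Real.exp σ₀ * (Real.exp (wT * ‖B‖) - 1) * Real.exp σ₀ := by
        refine add_le_add ?_ ?_
        · exact mul_le_mul (mul_le_mul hE hP (norm_nonneg _) (mul_nonneg (Real.exp_pos _).le hα)) hYn (norm_nonneg _)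
            (mul_nonneg (mul_nonneg (Real.exp_pos _).le hα) (Real.exp_pos _).le)
        · exact mul_le_mul (mul_le_mul hY hPd (norm_nonneg _) (Real.exp_pos _).le) hYn (norm_nonneg _)
            (mul_nonneg (Real.exp_pos _).le hPd0)
    _ = Real.exp (2 * σ₀) * (α * Real.exp α * Real.exp (wT * ‖B‖) + (Real.exp (wT * ‖B‖) - 1)) := by
        rw [Real.exp_add, two_mul, Real.exp_add]; ring

variable {R f : ℝ} (hT : LipWord T wT) (hSan : ∀ B : E, ‖B‖ < R → AnalyticAt ℂ S B) (hS0 : ‖S 0‖ ≤ σ₀)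
  (hSB : ∀ B : E, ‖B‖ < R → ‖S B - S 0‖ ≤ α)
  (hf : Real.exp (2 * σ₀) * (α * Real.exp α * Real.exp (wT * R) + (Real.exp (wT * R) - 1)) ≤ f) (hf1 : f < 1)
include hT hS0 hSB hf

/-- On `‖B‖ < R` the quotient is within `f` of `1` (`e^{w_T‖B‖} ≤ e^{w_T R}`). [folklore] -/
theorem norm_quot_sub_one_le_of_ball {B : E} (hB : ‖B‖ < R) :
    ‖(((expU (S B) * T B) * (expU (S 0) * T 0)⁻¹ : 𝔸ˣ) : 𝔸) - 1‖ ≤ f := by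
  have hα : 0 ≤ α := (norm_nonneg _).trans (hSB B hB)
  have h1 := norm_quot_sub_one_le_sharp hT hS0 (hSB B hB)
  have h2 : Real.exp (wT * ‖B‖) ≤ Real.exp (wT * R) :=
    Real.exp_le_exp.2 (mul_le_mul_of_nonneg_left hB.le hT.expWord.nonneg)
  refine h1.trans (le_trans ?_ hf)
  refine mul_le_mul_of_nonneg_left ?_ (Real.exp_pos _).le
  exact add_le_add (mul_le_mul_of_nonneg_left h2 (by positivity)) (sub_le_sub_right h2 1)

include hSan hf1

/-- **THE CHART AVERAGE IS ANALYTIC ON `ball 0 R`** (sharp form): `B ↦ (−i)·log(e^{S(B)}T(B)(e^{S(0)}T(0))⁻¹)` is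
complex-analytic on a neighbourhood of every point of the ball, the quotient staying within `f < 1` of `1`.
[folklore] -/
theorem chartAverage_analyticOnNhd_sharp :
    AnalyticOnNhd ℂ (fun B => (-Complex.I) • mlog (((expU (S B) * T B) * (expU (S 0) * T 0)⁻¹ : 𝔸ˣ) : 𝔸))
      (ball 0 R) := fun B hB => by
  have hB' : ‖B‖ < R := mem_ball_zero_iff.1 hB
  have hlt : ‖(((expU (S B) * T B) * (expU (S 0) * T 0)⁻¹ : 𝔸ˣ) : 𝔸) - 1‖ < 1 :=
    (norm_quot_sub_one_le_of_ball hT hS0 hSB hf hB').trans_lt hf1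
  exact ((MatrixLog.analyticAt_mlog hlt).comp_of_eq (analyticAt_quot hT.expWord (hSan B hB')) rfl).fun_const_smul

omit hSan in
/-- **THE CHART AVERAGE IS BOUNDED BY `−ln(1 − f)` ON `ball 0 R`** (sharp form; (26) p. 22, first member).
[folklore] -/
theorem norm_chartAverage_le_sharp {B : E} (hB : ‖B‖ < R) :
    ‖(-Complex.I) • mlog (((expU (S B) * T B) * (expU (S 0) * T 0)⁻¹ : 𝔸ˣ) : 𝔸)‖ ≤ -Real.log (1 - f) := by
  rw [norm_smul, norm_neg, Complex.norm_I, one_mul]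
  have h1 := norm_quot_sub_one_le_of_ball hT hS0 hSB hf hB
  have hlt : ‖(((expU (S B) * T B) * (expU (S 0) * T 0)⁻¹ : 𝔸ˣ) : 𝔸) - 1‖ < 1 := h1.trans_lt hf1
  refine (norm_mlog_le_neg_log hlt).trans ?_
  have hpos : 0 < 1 - f := by linarith
  exact neg_le_neg (Real.log_le_log hpos (by linarith))

end Quotient

end Summit.QuantumFields.BalabanUV.T4Continuum.ShellMeasureAverageLipschitzChart
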